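import Summits.BirchSwinnertonDyer.BirchSwinnertonDyer.Theorems.TwoAdicConverseOrdLambdaHalfAtTwoWbarLocal
import Summits.BirchSwinnertonDyer.BirchSwinnertonDyer.Theorems.TwoAdicConverseOrdLambdaHalfAtTwoWbarKerVanishing
import Literature.NumberTheory.EllipticCurves.ZpExtensionEisensteinDVRSettingDualityDataProofs
import Literature.NumberTheory.EllipticCurves.ZpExtensionRestrictCyclotomic
import Mathlib.Topology.Algebra.ClopenNhdofOne
import HarnessLib

/-!
# Route `TwoAdicConverse` (rung S3), crux `OrdLambdaHalfAtTwo` (item stmt-BirchSwinnertonDyer-19556), line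
# `kato-determinant-greenberg-two`, stub `stub_wbarStepAtTwo` ([C]) — brick C (the cor–Ver step): **a quadratic character of
# `K_∞ = K·ℚ_∞` unramified outside `2` is invariant under the lift of complex conjugation**

Cell `bsd-2adic`, seat `bsd-2adic-conv-1` GEN 26 (`--supports` stmt-BirchSwinnertonDyer-19556, helper; pen RC-325, (h3)).  `K` imaginary
quadratic, `κ_K` its cyclotomic `ℤ₂`-extension, `H = ker κ_K = Gal(K̄/K_∞)`, `M` of order `2` with trivial action, `z : H → M` a
continuous cocycle (= character) killing `H ∩ I_𝔓` for every prime `𝔓` of `\bar ℤ_K` above every odd place.  Let `c₀ ∈ Γ_ℚ` be a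
complex conjugation, `τ̃ = e c₀ e⁻¹` its transport to `K̄` (a lift of the non-trivial `σ ∈ Gal(K/ℚ)`), `φ(x) = τ̃⁻¹ x τ̃`
(`IsLiftOfAut.conjGalCMH`).  THEN `z(φ x) = z(x)` on `H` (`apply_conjGalCMH_eq`).

Proof (cruxtriage-19556-r1-1 GEN 11 Δ1, transfer-free form).  Along `res : Γ_K ↪ Γ_ℚ` (image `R` of index `2`, `c₀ ∉ R`,
`c₀ ∈ G := Gal(ℚ̄/ℚ_∞)`, `res⁻¹ G = H`), the `φ`-invariant character `d = z + z∘φ` of `H` extends to `g : G → M`,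
`g(y) = d(res⁻¹ y)` on `R ∩ G` and `g(y) = d(res⁻¹(y c₀))` off `R` — this is `cor(z)`; for `y ∉ R`, `g(y) = z(res⁻¹(y²))`.
`g` is additive on `G`, vanishes near `1`, on every inertia group above an odd prime (brick L's transport, as `y` or `y²`
restricts into an inertia group of `\bar ℤ_K`) and on every complex conjugation (`y² = 1`).  Brick R2 (`ker_vanishing`: `ℚ_∞` has
no quadratic extension unramified at the odd primes and at `∞`) gives `g = 0`, i.e. `z∘φ = z` (order `2`).

HONEST FRAMING: theorems only (no definition, no named fact, no `sorry`); BSD is not proved by any of this.  PARTITION (D-0054):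
none — RANK axis S3 × X5@2 stratum (β); types-the-object-of (stub 3b-C).  References: [cite: Washington1997, §13.1];
[cite: NeukirchSchmidtWingberg2008, (1.5.9) (cor ∘ res, transfer)]; [cite: GrossLMS1991, §3 (τ lifts complex conjugation)].
-/

set_option autoImplicit false
-- the route's Theorems namespace repeats the summit name by design (D-0017 nested layout)
set_option linter.dupNamespace false

noncomputable section

open scoped Classical NumberField Pointwise

namespace Summit.BirchSwinnertonDyer.BirchSwinnertonDyer.Theorems.TwoAdicWbarStep

open Function NumberField IsDedekindDomain Field
  Literature.NumberTheory.GaloisRepresentations Literature.NumberTheory.EllipticCurves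
  Summit.BirchSwinnertonDyer.BirchSwinnertonDyer.Theorems.TwoAdicGreenbergCotorsion
  Summit.BirchSwinnertonDyer.BirchSwinnertonDyer.Theorems.PrintCFram.HerbrandSelmerToHom

variable {K : Type} [Field K] [NumberField K]
  {M : Type} [AddCommGroup M] [DistribMulAction (absoluteGaloisGroup K) M] [TopologicalSpace M] [DiscreteTopology M]

set_option synthInstance.maxHeartbeats 100000 in
-- the pointwise `MulAction` of `Γ_ℚ` on the ideals of `\bar ℤ` is found slowly under these imports (as in `…SelmerToHomPrimes`)
/-- **The cor–Ver step.**  `K` imaginary quadratic, `κ_K` cyclotomic, `H = ker κ_K`, `M` of order `2` (trivial action), `z` a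
continuous cocycle of `H` killing `H ∩ I_𝔓` for all primes `𝔓` of `\bar ℤ_K` above the odd places; `c₀ ∈ Γ_ℚ` a complex
conjugation whose transport `τ̃` to `K̄` lifts `σ ≠ 1`.  Then `z (τ̃⁻¹ x τ̃) = z x` for every `x ∈ H`. [cite: Washington1997, §13.1]
[cite: NeukirchSchmidtWingberg2008, (1.5.9)] -/
theorem apply_conjGalCMH_eq (hK : IsImaginaryQuadratic K) {κK : ZpExtension K 2} (hκK : κK.IsCyclotomic)
    (hM : Nat.card M = 2) (htriv : ∀ (σ : absoluteGaloisGroup K) (m : M), σ • m = m)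
    (z : contOneCocycles (discreteTopRep κK.kerSubgroup M))
    (hI : ∀ u : HeightOneSpectrum (𝓞 K), ((2 : ℕ) : 𝓞 K) ∉ u.asIdeal → ∀ 𝔓 ∈ u.primesAbove,
      ∀ (n : absoluteGaloisGroup K) (hnH : n ∈ κK.kerSubgroup), n ∈ 𝔓.inertia (absoluteGaloisGroup K) → z.1 ⟨n, hnH⟩ = 0)
    {σ : K ≃ₐ[ℚ] K} {c₀ : absoluteGaloisGroup ℚ} (hc₀ : IsComplexConjugation (Rat.castHom ℝ) c₀)
    (hτ : IsLiftOfAut σ (absGaloisTransport (K := ℚ) (L := K) c₀).toRingEquiv)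
    (x : absoluteGaloisGroup K) (hx : x ∈ κK.kerSubgroup) (hφx : (hτ.conjGalCMH x : absoluteGaloisGroup K) ∈ κK.kerSubgroup) :
    z.1 ⟨hτ.conjGalCMH x, hφx⟩ = z.1 ⟨x, hx⟩ := by
  haveI : Algebra.IsQuadraticExtension ℚ K := ⟨hK.1⟩
  haveI : IsTotallyComplex K := hK.2
  haveI : NeZero ((2 : ℕ) : ℚ) := ⟨by norm_num⟩
  set κ := CyclotomicZp.zpExtension 2 with hκdef
  have hκ : κ.IsCyclotomic := CyclotomicZp.isCyclotomic_zpExtension 2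
  set G := κ.kerSubgroup with hGdef
  set res := absGaloisRestrict ℚ K with hresdef
  set φ := hτ.conjGalCMH with hφdef
  set R : Set (absoluteGaloisGroup ℚ) := Set.range res with hRdef
  -- (1) `κK.kerSubgroup = res⁻¹ G`
  have hHG : ∀ y : absoluteGaloisGroup K, y ∈ κK.kerSubgroup ↔ res y ∈ G := fun y ↦ by
    have e1 : κK.kerSubgroup = (CommGroup.torsion ℤ_[2]ˣ).comap (GaloisRep.cyclotomicCharacter K 2).toMonoidHom := hκK
    have e2 : G = (CommGroup.torsion ℤ_[2]ˣ).comap (GaloisRep.cyclotomicCharacter ℚ 2).toMonoidHom := hκ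
    rw [e1, e2, Subgroup.mem_comap, Subgroup.mem_comap]
    change GaloisRep.cyclotomicCharacter K 2 y ∈ _ ↔ GaloisRep.cyclotomicCharacter ℚ 2 (res y) ∈ _
    rw [hresdef, cyclotomicCharacter_absGaloisRestrict ℚ K 2 y]
  -- (2) `res ∘ φ = conj_{c₀} ∘ res`, `c₀² = 1`, `c₀ ∈ G ∖ R`
  have hresφ : ∀ y, res (φ y) = c₀⁻¹ * res y * c₀ := fun y ↦
    absGaloisRestrict_conjGalCMH_of_absGaloisTransport hτ c₀ (fun _ ↦ rfl) y
  have hc2 : c₀ * c₀ = 1 := by rw [← pow_two]; exact hc₀.sq_eq_one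
  have hcinv : c₀⁻¹ = c₀ := inv_eq_of_mul_eq_one_right hc2
  have hc₀G : c₀ ∈ G := mem_kerSubgroup_of_isComplexConjugation κ hc₀
  have hc₀R : c₀ ∉ R := hc₀.not_mem_range_absGaloisRestrict (L := K) fun w ↦ IsTotallyComplex.isComplex w
  have hinj : Function.Injective res := absGaloisRestrict_injective ℚ K
  -- (3) `φ` preserves `κK.kerSubgroup`, `φ ∘ φ = id`
  have hφH : ∀ y, y ∈ κK.kerSubgroup ↔ φ y ∈ κK.kerSubgroup := fun y ↦ by
    rw [hHG, hHG, hresφ]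
    constructor
    · intro h
      have := (ZpExtension.kerSubgroup_normal κ).conj_mem _ h c₀⁻¹
      rwa [inv_inv] at this
    · intro h
      have := (ZpExtension.kerSubgroup_normal κ).conj_mem _ h c₀
      rwa [show c₀ * (c₀⁻¹ * res y * c₀) * c₀⁻¹ = res y by group] at this
  have hφφ : ∀ y, φ (φ y) = y := fun y ↦ hinj (by
    rw [hresφ, hresφ, hcinv, show c₀ * (c₀ * res y * c₀) * c₀ = (c₀ * c₀) * res y * (c₀ * c₀) by group, hc2, one_mul,
      mul_one])
  -- (4) coset bookkeeping in `Γ_ℚ`: `R` has index `2`, `c₀ ∉ R`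
  have hRmul : ∀ y₁ y₂, y₁ ∈ R → y₂ ∈ R → y₁ * y₂ ∈ R := by
    rintro _ _ ⟨a, rfl⟩ ⟨b, rfl⟩; exact ⟨a * b, map_mul res a b⟩
  have hRinv : ∀ y, y ∈ R → y⁻¹ ∈ R := by
    rintro _ ⟨a, rfl⟩; exact ⟨a⁻¹, map_inv res a⟩
  have hoff : ∀ y₁ y₂, y₁ ∉ R → y₂ ∉ R → y₁ * y₂ ∈ R := fun y₁ y₂ h₁ h₂ ↦ by
    have h := inv_mul_mem_range_absGaloisRestrict (K := ℚ) (L := K) hK.1 (ρ := y₁⁻¹) (ρ' := y₂)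
      (fun h ↦ h₁ (by simpa using hRinv _ h)) h₂
    rwa [inv_inv] at h
  have hoffR : ∀ y, y ∉ R → y * c₀ ∈ R := fun y hy ↦ hoff y c₀ hy hc₀R
  have hmixed : ∀ y₁ y₂, y₁ ∈ R → y₂ ∉ R → y₁ * y₂ ∉ R := fun y₁ y₂ h₁ h₂ h ↦
    h₂ (by simpa using hRmul _ _ (hRinv _ h₁) h)
  have hmixed' : ∀ y₁ y₂, y₁ ∉ R → y₂ ∈ R → y₁ * y₂ ∉ R := fun y₁ y₂ h₁ h₂ h ↦
    h₁ (by simpa using hRmul _ _ h (hRinv _ h₂))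
  -- (5) the partial inverse `L` of `res`
  set L : absoluteGaloisGroup ℚ → absoluteGaloisGroup K := Function.invFun res with hLdef
  have hL : ∀ y, L (res y) = y := Function.leftInverse_invFun hinj
  have hresL : ∀ y, y ∈ R → res (L y) = y := fun y hy ↦ Function.invFun_eq hy
  have hLmul : ∀ y₁ y₂, y₁ ∈ R → y₂ ∈ R → L (y₁ * y₂) = L y₁ * L y₂ := fun y₁ y₂ h₁ h₂ ↦
    hinj (by rw [hresL _ (hRmul _ _ h₁ h₂), map_mul, hresL _ h₁, hresL _ h₂])
  have hLconj : ∀ y, y ∈ R → L (c₀⁻¹ * y * c₀) = φ (L y) := fun y hy ↦ by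
    have hmem : c₀⁻¹ * y * c₀ ∈ R := by
      rw [← hresL y hy, ← hresφ]; exact ⟨_, rfl⟩
    exact hinj (by rw [hresL _ hmem, hresφ, hresL y hy])
  have hLH : ∀ y, y ∈ R → (y ∈ G ↔ L y ∈ κK.kerSubgroup) := fun y hy ↦ by rw [hHG, hresL y hy]
  -- (6) `zext`, `d` on `Γ_K`
  set zext : absoluteGaloisGroup K → M := fun y ↦ if hy : y ∈ κK.kerSubgroup then z.1 ⟨y, hy⟩ else 0 with hzextdef
  have hzH : ∀ (y) (hy : y ∈ κK.kerSubgroup), zext y = z.1 ⟨y, hy⟩ := fun y hy ↦ by rw [hzextdef]; exact dif_pos hy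
  have hzoff : ∀ y, y ∉ κK.kerSubgroup → zext y = 0 := fun y hy ↦ by rw [hzextdef]; exact dif_neg hy
  have hzadd : ∀ y₁ ∈ κK.kerSubgroup, ∀ y₂ ∈ κK.kerSubgroup, zext (y₁ * y₂) = zext y₁ + zext y₂ := fun y₁ h₁ y₂ h₂ ↦ by
    rw [hzH y₁ h₁, hzH y₂ h₂, hzH _ (mul_mem h₁ h₂)]
    exact cocycle_mul_of_trivial htriv z ⟨y₁, h₁⟩ ⟨y₂, h₂⟩
  set d : absoluteGaloisGroup K → M := fun y ↦ zext y + zext (φ y) with hddef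
  have hd : ∀ y, d y = zext y + zext (φ y) := fun _ ↦ rfl
  have hdadd : ∀ y₁ ∈ κK.kerSubgroup, ∀ y₂ ∈ κK.kerSubgroup, d (y₁ * y₂) = d y₁ + d y₂ := fun y₁ h₁ y₂ h₂ ↦ by
    rw [hd, hd, hd, map_mul, hzadd y₁ h₁ y₂ h₂, hzadd _ ((hφH y₁).mp h₁) _ ((hφH y₂).mp h₂)]
    abel
  have hdφ : ∀ y, d (φ y) = d y := fun y ↦ by rw [hd, hd, hφφ, add_comm]
  have hdoff : ∀ y, y ∉ κK.kerSubgroup → d y = 0 := fun y hy ↦ by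
    rw [hd, hzoff y hy, hzoff _ (fun h ↦ hy ((hφH y).mpr h)), add_zero]
  -- for `y ∈ κK.kerSubgroup`, `d y = z (y · φ y)`
  have hdprod : ∀ (y) (hy : y ∈ κK.kerSubgroup), d y = zext (y * φ y) := fun y hy ↦ by
    rw [hd, hzadd y hy _ ((hφH y).mp hy)]
  -- (7) the extension `g` on `Γ_ℚ`
  set g : absoluteGaloisGroup ℚ → M := fun y ↦ if y ∈ R then d (L y) else d (L (y * c₀)) with hgdef
  have hgR : ∀ y, y ∈ R → g y = d (L y) := fun y hy ↦ by rw [hgdef]; exact if_pos hy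
  have hgoff : ∀ y, y ∉ R → g y = d (L (y * c₀)) := fun y hy ↦ by rw [hgdef]; exact if_neg hy
  -- off `R`: `g y = zext (res⁻¹ (y²))`
  have hsq : ∀ y, y ∉ R → res (L (y * c₀) * φ (L (y * c₀))) = y * y := fun y hy ↦ by
    rw [map_mul, hresφ, hresL _ (hoffR y hy), hcinv,
      show y * c₀ * (c₀ * (y * c₀) * c₀) = y * (c₀ * c₀) * y * (c₀ * c₀) by group, hc2]
    group
  -- for `y ∈ G ∖ R`: `g y = z (res⁻¹ (y²))`
  have hGoffH : ∀ y, y ∈ G → y ∉ R → L (y * c₀) ∈ κK.kerSubgroup := fun y hyG hyR ↦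
    (hLH _ (hoffR y hyR)).mp (mul_mem hyG hc₀G)
  have hgsq : ∀ (y) (hyG : y ∈ G) (hyR : y ∉ R),
      g y = z.1 ⟨L (y * c₀) * φ (L (y * c₀)), mul_mem (hGoffH y hyG hyR) ((hφH _).mp (hGoffH y hyG hyR))⟩ :=
    fun y hyG hyR ↦ by rw [hgoff y hyR, hdprod _ (hGoffH y hyG hyR), hzH]
  -- (8a) additivity of `g` on `G`
  have hGadd : ∀ y₁ ∈ G, ∀ y₂ ∈ G, g (y₁ * y₂) = g y₁ + g y₂ := by
    intro y₁ hy₁ y₂ hy₂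
    by_cases h₁ : y₁ ∈ R <;> by_cases h₂ : y₂ ∈ R
    · rw [hgR _ (hRmul _ _ h₁ h₂), hgR _ h₁, hgR _ h₂, hLmul _ _ h₁ h₂,
        hdadd _ ((hLH _ h₁).mp hy₁) _ ((hLH _ h₂).mp hy₂)]
    · rw [hgoff _ (hmixed _ _ h₁ h₂), hgR _ h₁, hgoff _ h₂, mul_assoc, hLmul _ _ h₁ (hoffR _ h₂),
        hdadd _ ((hLH _ h₁).mp hy₁) _ (hGoffH _ hy₂ h₂)]
    · have hmem : c₀⁻¹ * y₂ * c₀ ∈ R := by rw [← hresL _ h₂, ← hresφ]; exact ⟨_, rfl⟩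
      have e : y₁ * y₂ * c₀ = (y₁ * c₀) * (c₀⁻¹ * y₂ * c₀) := by group
      rw [hgoff _ (hmixed' _ _ h₁ h₂), hgoff _ h₁, hgR _ h₂, e, hLmul _ _ (hoffR _ h₁) hmem, hLconj _ h₂,
        hdadd _ (hGoffH _ hy₁ h₁) _ ((hφH _).mp ((hLH _ h₂).mp hy₂)), hdφ]
    · have hmem : c₀⁻¹ * (y₂ * c₀) * c₀ ∈ R := by rw [← hresL _ (hoffR _ h₂), ← hresφ]; exact ⟨_, rfl⟩
      have e : y₁ * y₂ = (y₁ * c₀) * (c₀⁻¹ * (y₂ * c₀) * c₀) := by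
        rw [show (y₁ * c₀) * (c₀⁻¹ * (y₂ * c₀) * c₀) = y₁ * y₂ * (c₀ * c₀) by group, hc2, mul_one]
      rw [hgR _ (hoff _ _ h₁ h₂), hgoff _ h₁, hgoff _ h₂, e, hLmul _ _ (hoffR _ h₁) hmem, hLconj _ (hoffR _ h₂),
        hdadd _ (hGoffH _ hy₁ h₁) _ ((hφH _).mp (hGoffH _ hy₂ h₂)), hdφ]
  -- (8b) `g` vanishes on `U ∩ G` for an open subgroup `U ≤ Γ_ℚ`
  have hU : ∃ U : Subgroup (absoluteGaloisGroup ℚ), IsOpen (U : Set (absoluteGaloisGroup ℚ)) ∧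
      ∀ y ∈ U, y ∈ G → g y = 0 := by
    have hφc : Continuous fun y : κK.kerSubgroup ↦ (⟨φ y, (hφH y).mp y.2⟩ : κK.kerSubgroup) :=
      (φ.continuous.comp continuous_subtype_val).subtype_mk _
    have hS : IsOpen {y : κK.kerSubgroup | z.1 y = 0 ∧ z.1 ⟨φ y, (hφH y).mp y.2⟩ = 0} :=
      ((isOpen_discrete {(0 : M)}).preimage z.1.continuous).inter
        ((isOpen_discrete {(0 : M)}).preimage (z.1.continuous.comp hφc))
    obtain ⟨O, hO, hOS⟩ := isOpen_induced_iff.mp hS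
    have hz1 : z.1 1 = 0 := cocycle_one_of_trivial htriv z
    have h1O : (1 : absoluteGaloisGroup K) ∈ O := by
      have h1 : (1 : κK.kerSubgroup) ∈ Subtype.val ⁻¹' O := by
        rw [hOS]
        refine ⟨hz1, ?_⟩
        have e : (⟨φ (1 : κK.kerSubgroup), (hφH _).mp (1 : κK.kerSubgroup).2⟩ : κK.kerSubgroup) = 1 := Subtype.ext (by simp)
        rw [e]; exact hz1
      exact h1
    obtain ⟨V, hV⟩ := ProfiniteGrp.exist_openNormalSubgroup_sub_open_nhds_of_one hO h1O
    refine ⟨(V : Subgroup (absoluteGaloisGroup K)).map res.toMonoidHom, ?_, ?_⟩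
    · haveI : (V : Subgroup (absoluteGaloisGroup K)).FiniteIndex := by
        haveI := Subgroup.quotient_finite_of_isOpen _ V.isOpen'
        exact Subgroup.finiteIndex_of_finite_quotient
      haveI : ((V : Subgroup (absoluteGaloisGroup K)).map res.toMonoidHom).FiniteIndex := by
        refine ⟨?_⟩
        have h2 : res.toMonoidHom.range.index = 2 := by
          have h := nat_card_quotient_range_absGaloisRestrict ℚ K
          rw [hK.1] at h
          exact h
        rw [Subgroup.index_map, (MonoidHom.ker_eq_bot_iff _).mpr hinj, sup_bot_eq, h2]
        exact mul_ne_zero Subgroup.FiniteIndex.index_ne_zero two_ne_zero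
      apply Subgroup.isOpen_of_isClosed_of_finiteIndex
      rw [Subgroup.coe_map]
      exact ((OpenSubgroup.isClosed V.toOpenSubgroup).isCompact.image res.continuous).isClosed
    · rintro _ ⟨y, hyV, rfl⟩ hyG
      change res y ∈ G at hyG
      have hyH : y ∈ κK.kerSubgroup := (hHG y).mpr hyG
      have hyS : (⟨y, hyH⟩ : κK.kerSubgroup) ∈ Subtype.val ⁻¹' O := hV hyV
      rw [hOS] at hyS
      obtain ⟨h1, h2⟩ := hyS
      change g (res y) = 0
      rw [hgR _ ⟨y, rfl⟩, hL, hd, hzH y hyH, hzH _ ((hφH y).mp hyH), h1, h2, add_zero]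
  -- (8c) `g` vanishes on the inertia groups above odd primes
  have hI2 : ∀ (y : absoluteGaloisGroup K) (hyH : y ∈ κK.kerSubgroup) (u : HeightOneSpectrum (𝓞 ℚ)), ((2 : ℕ) : 𝓞 ℚ) ∉ u.asIdeal →
      ∀ 𝔓 ∈ u.primesAbove, res y ∈ 𝔓.inertia (absoluteGaloisGroup ℚ) → z.1 ⟨y, hyH⟩ = 0 :=
    fun y hyH u hu 𝔓 h𝔓 hy ↦ apply_eq_zero_of_absGaloisRestrict_mem_inertia κK.kerSubgroup z hI hu h𝔓 hyH hy
  have hgI : ∀ u : HeightOneSpectrum (𝓞 ℚ), ((2 : ℕ) : 𝓞 ℚ) ∉ u.asIdeal →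
      ∀ 𝔓 ∈ u.primesAbove, ∀ y ∈ 𝔓.inertia (absoluteGaloisGroup ℚ), g y = 0 := by
    intro u hu 𝔓 h𝔓 y hy
    have hyG : y ∈ G := ZpExtension.inertia_le_kerSubgroup_of_isCyclotomic κ hκ hu h𝔓 hy
    by_cases hyR : y ∈ R
    · have hLy : L y ∈ κK.kerSubgroup := (hLH _ hyR).mp hyG
      have h1 : z.1 ⟨L y, hLy⟩ = 0 := hI2 _ hLy u hu 𝔓 h𝔓 (by rw [hresL _ hyR]; exact hy)
      have h𝔓' : c₀⁻¹ • 𝔓 ∈ u.primesAbove := PrintCFram.HerbrandSelmerToHom.smul_mem_primesAbove h𝔓 c₀⁻¹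
      have hy' : c₀⁻¹ * y * c₀ ∈ (c₀⁻¹ • 𝔓).inertia (absoluteGaloisGroup ℚ) :=
        conj_mem_inertia_of_mem (𝔓 := c₀⁻¹ • 𝔓) (τ := c₀) (n := y) (by rwa [smul_inv_smul])
      have h2 : z.1 ⟨φ (L y), (hφH _).mp hLy⟩ = 0 :=
        hI2 _ ((hφH _).mp hLy) u hu _ h𝔓' (by rw [hresφ, hresL _ hyR]; exact hy')
      rw [hgR _ hyR, hd, hzH _ hLy, hzH _ ((hφH _).mp hLy), h1, h2, add_zero]
    · rw [hgsq y hyG hyR]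
      exact hI2 _ _ u hu 𝔓 h𝔓 (by rw [hsq y hyR]; exact mul_mem hy hy)
  -- (8d) `g` vanishes on complex conjugations
  have hgcc : ∀ c : absoluteGaloisGroup ℚ, IsComplexConjugation (Rat.castHom ℝ) c → g c = 0 := by
    intro c hc
    have hcG : c ∈ G := mem_kerSubgroup_of_isComplexConjugation κ hc
    have hcR : c ∉ R := hc.not_mem_range_absGaloisRestrict (L := K) fun w ↦ IsTotallyComplex.isComplex w
    have hone : L (c * c₀) * φ (L (c * c₀)) = 1 := hinj (by
      rw [hsq c hcR, ← pow_two, hc.sq_eq_one, map_one])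
    rw [hgsq c hcG hcR]
    have e : (⟨L (c * c₀) * φ (L (c * c₀)), mul_mem (hGoffH c hcG hcR) ((hφH _).mp (hGoffH c hcG hcR))⟩ : κK.kerSubgroup) = 1 :=
      Subtype.ext hone
    rw [e]
    exact cocycle_one_of_trivial htriv z
  -- (9) brick R2: `g = 0` on `G`; read off at `res x`
  have hall := ker_vanishing M hM g hGadd hU hgI hgcc
  have hxG : res x ∈ G := (hHG x).mp hx
  have h0 := hall (res x) hxG
  rw [hgR _ ⟨x, rfl⟩, hL, hd, hzH x hx, hzH _ ((hφH x).mp hx)] at h0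
  exact ((add_eq_zero_iff_eq_of_card_eq_two hM).mp h0).symm

end Summit.BirchSwinnertonDyer.BirchSwinnertonDyer.Theorems.TwoAdicWbarStep

end
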